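import Summits.HodgeConjecture.CorCM.Census.OcticTwistScrewReduction
import Summits.HodgeConjecture.CorCM.Census.OcticTwistSandwich

/-!
# The octic twist `(ℤ/8 × B, (4,0))`, XXVIII: THE SCREW LAW — `μ_hodge(ℤ/8 × B, (4,0)) = β − 2` EXACTLY when `B` has an element of order
# divisible by `8`

COR-CM (cell `pub-hodgecm2`), count-neutral kernel combinatorics by the binder seat b09 (gen 35; lane COINVARIANT-TWIST / OCTIC RECON, the
screw column — last column of the octic law), on top of parts XXIV–XXVII (the screw column: `raffine`, `Shaped`, `exists_screw_family`,
`cst_tens_Wvec_mem_of_screw`, screw-type lemmas), parts XII–XXI (`closing_mixed_mem_upper`, `closing_column_mem_upper`,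
`closing_square_mem_upper`, `D0_mem`, `D1_mem`, `X_base_mem`, `X_col_mem`, `X0_mem`, `X1_mem`, `closing_moves`, `residual₂_mem`,
`exists_reduced₂`, `card_blocks_split`, `ten_le_card_residual_blocks`, `diag_mem`, `swap_mem`, the floor `card_orb₂_le_card_add_two`) and the
quartic files (`exists_screw`, `exists_orientedSquare`, `exists_equator'`, `isUpper_move_of_balanced`, `exists_place`, `transl_Wvec`) BY NAME.
Theorems only; no definition, no certificate, no named fact, no `sorry`.
HONEST FRAMING: `HC_CM` is NOT proved, here or anywhere in the tree; nothing here is a period or a headline.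

* §1 THE SCREW DATUM (`exists_screw_datum`, `8 ∣ ord τ`): a quartic screw type `ψ` for `τ + τ` (balanced, `Φ ≥ 4`), `ψ′ = (0,τ)·ψ` (so that
  the odd motion `act true (0,τ)` fixes `T₀ = (ψ, ψ′)`), an oriented square `(ψ′; p′, q′)` offering an upper end `v`, a column `b` with
  `ψ b = v + 1` lowered to `ψ⁻ = ψ − δ_b` (upper end `v` by lemma K4), `ψ′⁻ = (0,τ)·ψ⁻`; the mixed face `(e_ψ − e_{ψ⁻}) ⊗ (e_{ψ′} − e_{ψ′⁻})`
  and the square `e_{ψ⁻} ⊗ (ψ′; p′, q′)` are octic faces with lower corners of smaller potential.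
* §2 **`exists_faces_generate₂_screw`**: there is a family `S` of octic rank-four faces with `hodge₂ ≤ pairs₂ ⊔ spanMot S` and
  `|S| + 2 ≤ β` — the screw-adapted covering family (one face per block of potential `≥ 2`, the two special blocks carrying the two faces of
  §1) plus only EIGHT closing faces: the six mixed ones, the column one and the equatorial one `⊗ e_1`; the Weil lift `w_1 ⊗ e_0` that the
  dropped equatorial face `⊗ e_0` used to supply is handed over by the screw (part XXVII), after which the closing moves and the residual
  theorem run verbatim.  (Dropping `⊗ e_1` instead does NOT work: the eight remaining closing classes then have dependent block parities —
  design note `HOME/pub-hodgecm2-b09/lean-g35/SCREW.md`.)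
* §3 **`octicTwist_law_screw`** (`|B| ≥ 3`, `∃ τ ∈ B, 8 ∣ ord τ`): (∃ `S ⊆ IsFace₂` generating with `|S| + 2 = β`) ∧ (every generating
  family has `β ≤ |S| + 2`, part XXI) — **`μ_hodge(ℤ/8 × B, (4,0)) = β − 2` EXACTLY**, the `j = 2`, `δ = 1` value of the twist fibre law
  `Census/CoinvariantTwistLaw.lean`.  With part XXIII: `μ_hodge(ℤ/8 × B, (4,0)) = β − 1 − [∃ t ∈ B, 8 ∣ ord t]` for every finite `B`, `|B| ≥ 3`.
All [folklore].

## References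
* [Pohlmann1968] H. Pohlmann, Algebraic cycles on abelian varieties of complex multiplication type, Ann. of Math. 88 (1968), Thm 1.
* [Milne1999] J. S. Milne, Lefschetz motives and the Tate conjecture, Compositio Math. 117 (1999), Prop. 2.1, p. 54.
-/

namespace Summit.HodgeConjecture.CorCM.Census.OcticTwist

open Finset
open Summit.HodgeConjecture.CorCM.Census.QuarticTwist

variable (B : Type) [AddGroup B] [Fintype B] [DecidableEq B]

/-! ## §1 The screw datum -/

/-- **THE SCREW DATUM** (`|B| ≥ 3`, `8 ∣ ord τ`): the screw pair type, its neighbours, the oriented square at `ψ′` and all the bookkeeping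
facts used by parts XXVI–XXVII. [folklore] -/
theorem exists_screw_datum (h3 : 3 ≤ Fintype.card B) {τ : B} (h8 : 8 ∣ addOrderOf τ) :
    ∃ (ψ ψ' ψm ψ'm : Ty B) (v : ZMod 4) (p' q' : ZMod 2 × B),
      tw B (1, τ) ψ' = ψ ∧ tw B (0, τ) ψ = ψ' ∧ tw B (0, τ) ψm = ψ'm ∧ (∀ w, IsMin B w ψ) ∧ (∀ w, IsMin B w ψ') ∧ ¬ IsRes B ψm ∧
      IsUpper B v ψm ∧ p'.2 ≠ q'.2 ∧
      (Phi B (QuarticTwist.flip B p' ψ') < Phi B ψ' ∧ IsUpper B v (QuarticTwist.flip B p' ψ')) ∧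
      (Phi B (QuarticTwist.flip B q' ψ') < Phi B ψ' ∧ IsUpper B v (QuarticTwist.flip B q' ψ')) ∧
      (Phi B (QuarticTwist.flip B q' (QuarticTwist.flip B p' ψ')) < Phi B ψ' ∧ IsUpper B v (QuarticTwist.flip B q' (QuarticTwist.flip B p' ψ'))) ∧
      IsFace₂ B (tens B (Pi.single ψ 1 - Pi.single ψm 1) (Pi.single ψ' 1 - Pi.single ψ'm 1)) ∧
      IsFace₂ B (tens B (Pi.single ψm 1) (faceVec B ψ' p' q')) ∧
      pot B (ψm, ψ') < pot B (ψ, ψ') ∧ pot B (ψ, ψ'm) < pot B (ψ, ψ') ∧ pot B (ψm, ψ'm) < pot B (ψ, ψ') ∧ 2 ≤ pot B (ψm, ψ') := by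
  have h4 : 4 ∣ addOrderOf (τ + τ) := four_dvd_addOrderOf_add_self B h8
  obtain ⟨ψ, hψ⟩ := exists_screw B h4
  have hE2 : tw B (0, τ) ψ = tw B (0, τ) ψ := rfl
  have hE1 : tw B (1, τ) (tw B (0, τ) ψ) = ψ := by
    rw [tw_tw, show ((1 : ZMod 4), τ) + (0, τ) = (1, τ + τ) from Prod.ext (add_zero 1) rfl, hψ]
  have hbal : ∀ w, IsMin B w ψ := balanced_of_screw B hψ
  have hbal' : ∀ w, IsMin B w (tw B (0, τ) ψ) := (balanced_tw_iff B (0, τ) ψ).mpr hbal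
  have hΦ : 4 ≤ Phi B ψ := four_le_Phi_of_screw B h4 hψ
  have hΦ' : Phi B (tw B (0, τ) ψ) = Phi B ψ := Phi_tw B _ _
  have hnr' : ¬ IsRes B (tw B (0, τ) ψ) := not_isRes_of_three_le_Phi B h3 (by omega)
  -- the oriented square at `ψ'`
  obtain ⟨v, p', q', hpq, -, ⟨h1, r1⟩, ⟨h2, r2⟩, ⟨h12, r12⟩⟩ := exists_orientedSquare B h3 hnr'
  -- a column with value `v + 1`, lowered
  obtain ⟨n, -, hn⟩ := exists_apply_eq_of_screw B hψ τ (v + 1)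
  set b : B := τ + n • (τ + τ) with hb
  obtain ⟨j, hj⟩ := exists_place (ψ b) (-1) (Or.inr rfl)
  have hflip : QuarticTwist.flip B (j, b) ψ = ψ + Pi.single b (-1) := by rw [flip_eq_add_single, hj]
  have key : ∀ v : ZMod 4, (lee (v + 1 + -1 - v) + 1 = lee (v + 1 - v)) ∧ (lee (v + 1 + -1 - (v - 1)) + 1 = lee (v + 1 - (v - 1))) := by
    decide
  obtain ⟨k1, k2⟩ := key v
  rw [← hn] at k1 k2
  obtain ⟨hum, hΦm⟩ := isUpper_move_of_balanced B hbal v b (-1) (Or.inr rfl) k1 k2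
  rw [← hflip] at hum hΦm
  set ψm := QuarticTwist.flip B (j, b) ψ with hψm
  have hnrm : ¬ IsRes B ψm := not_isRes_of_three_le_Phi B h3 (by omega)
  have hΦm' : Phi B (tw B (0, τ) ψm) = Phi B ψm := Phi_tw B _ _
  have hflip' : QuarticTwist.flip B (plc B (0, τ) (j, b)) (tw B (0, τ) ψ) = tw B (0, τ) ψm := by rw [hψm, tw_flip']
  refine ⟨ψ, tw B (0, τ) ψ, ψm, tw B (0, τ) ψm, v, p', q', hE1, rfl, rfl, hbal, hbal', hnrm, hum, hpq, ⟨h1, r1⟩, ⟨h2, r2⟩, ⟨h12, r12⟩,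
    ?_, ?_, ?_, ?_, ?_, ?_⟩
  · exact Or.inr (Or.inr ⟨ψ, tw B (0, τ) ψ, (j, b), plc B (0, τ) (j, b), by rw [hflip']⟩)
  · exact Or.inr (Or.inl ⟨ψm, tw B (0, τ) ψ, p', q', fun h => hpq (by rw [h]), rfl⟩)
  · rw [pot_mk, pot_mk]; omega
  · rw [pot_mk, pot_mk, hΦm']; omega
  · rw [pot_mk, pot_mk, hΦm']; omega
  · rw [pot_mk]; omega

/-! ## §2 Generation by `β − 2` faces -/

omit [AddGroup B] in
/-- Shapes are inherited by larger submodules. [folklore] -/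
theorem shaped_mono {N N' : Submodule ℤ (Ty₂ B → ℤ)} (hle : N ≤ N') {T : Ty₂ B} (h : Shaped B N T) : Shaped B N' T := by
  rcases h with h | ⟨u, p, q, hpq, hf, rest⟩ | ⟨u, p, q, hpq, hf, rest⟩ | ⟨u, b, hs, hrel⟩ | ⟨u, b, ht, hrel⟩
  · exact Or.inl h
  · exact Or.inr (Or.inl ⟨u, p, q, hpq, hle hf, rest⟩)
  · exact Or.inr (Or.inr (Or.inl ⟨u, p, q, hpq, hle hf, rest⟩))
  · exact Or.inr (Or.inr (Or.inr (Or.inl ⟨u, b, hs, hle hrel⟩)))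
  · exact Or.inr (Or.inr (Or.inr (Or.inr ⟨u, b, ht, hle hrel⟩)))

/-- From `e_{cst (v+1)} ⊗ w_{v+1}`: the Weil lift `w_1 ⊗ e_{cst 0}`, by a diagonal motion and the swap-twist. [folklore] -/
theorem Wvec_one_tens_cst_zero_mem {N : Submodule ℤ (Ty₂ B → ℤ)} (hmot : ∀ x ∈ N, ∀ (e : Bool) (h : ZMod 4 × B), transl₂ B e h x ∈ N)
    {v : ZMod 4} (hW : tens B (Pi.single (cst B (v + 1)) 1) (Wvec B (v + 1)) ∈ N) :
    tens B (Wvec B 1) (Pi.single (cst B 0) 1) ∈ N := by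
  have h1 := swap_mem B hmot hW
  rw [transl_Wvec] at h1
  have h2 := diag_mem B hmot h1 (-v - 1, (0 : B))
  rw [transl_Wvec, transl_single_cst] at h2
  have e1 : v + 1 + 1 + (-v - 1) = 1 := by ring
  have e2 : v + 1 + (-v - 1) = 0 := by ring
  rw [e1, e2] at h2
  exact h2

/-- **`μ(ℤ/8 × B, (4,0)) ≤ β − 2` WHEN `B` HAS AN ELEMENT OF ORDER DIVISIBLE BY `8`** (`|B| ≥ 3`): there is a finite family `S` of octic
rank-four faces whose motions generate the octic Hodge lattice modulo the octic pairs, integrally, with `|S| + 2 ≤ β = #Orb₂ B`. [folklore] -/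
theorem exists_faces_generate₂_screw (h3 : 3 ≤ Fintype.card B) {τ : B} (h8 : 8 ∣ addOrderOf τ) :
    ∃ S : Finset (Ty₂ B → ℤ), (∀ f ∈ S, IsFace₂ B f) ∧ hodge₂ B ≤ pairs₂ B ⊔ spanMot B S ∧
      S.card + 2 ≤ Fintype.card (Orb₂ B) := by
  classical
  obtain ⟨a, ha, hn⟩ : ∃ a : ℕ, 1 ≤ a ∧ (Fintype.card B = 2 * a + 1 ∨ Fintype.card B = 2 * a + 2) :=
    ⟨(Fintype.card B - 1) / 2, by omega, by omega⟩
  obtain ⟨Q, i, j, hQ, hi, hj, hji⟩ := exists_equator' B (a := a) (by omega)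
  obtain ⟨ψ, ψ', ψm, ψ'm, v, p', q', hE1, hE2, hE3, hbal, hbal', hnrm, hum, hpq, ⟨h11, r1⟩, ⟨h12, r2⟩, ⟨h13, r12⟩, hF₀, hF₁, h01, h02, h03,
    h2⟩ := exists_screw_datum B h3 h8
  obtain ⟨S, hSface, hScard, hcov₂, hsl, hsq, hF₀S, hF₁S, hShS⟩ :=
    exists_screw_family B h3 hbal hbal' hnrm hF₀ hF₁ h01 h02 h03 h11 h12 h13 h2
  -- the eight closing faces
  let P0 : Ty B := prof B Q i 0
  let P1 : Ty B := prof B Q i 1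
  let mixed : ZMod 4 → ZMod 4 → (Ty₂ B → ℤ) := fun Δ k =>
    tens B (Pi.single P0 1 - Pi.single P1 1) (Pi.single (atom B Δ i k) 1 - Pi.single (cst B Δ) 1)
  let col : Ty₂ B → ℤ := tens B (faceVec B P0 ((0 : ZMod 2), i) ((1 : ZMod 2), i)) (Pi.single (cst B 0) 1)
  let eqf : Ty₂ B → ℤ := tens B (faceVec B P0 ((0 : ZMod 2), i) ((0 : ZMod 2), j)) (Pi.single (cst B 1) 1)
  let L : List (Ty₂ B → ℤ) := [mixed 0 1, mixed 0 (-1), mixed 1 1, mixed 1 (-1), mixed 2 1, mixed 2 (-1), col, eqf]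
  let C : Finset (Ty₂ B → ℤ) := L.toFinset
  have hCcard : C.card ≤ 8 := (List.toFinset_card_le L).trans (by simp [L])
  have hm1 : (1 : ZMod 4) = 1 ∨ (1 : ZMod 4) = -1 := Or.inl rfl
  have hm2 : (-1 : ZMod 4) = 1 ∨ (-1 : ZMod 4) = -1 := Or.inr rfl
  have hCface : ∀ f ∈ C, IsFace₂ B f := by
    intro f hf
    have hf' : f ∈ L := List.mem_toFinset.mp hf
    simp only [L, List.mem_cons, List.mem_nil_iff, or_false] at hf'
    rcases hf' with rfl | rfl | rfl | rfl | rfl | rfl | rfl | rfl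
    · exact isFace₂_closing_mixed B Q hi 0 i hm1
    · exact isFace₂_closing_mixed B Q hi 0 i hm2
    · exact isFace₂_closing_mixed B Q hi 1 i hm1
    · exact isFace₂_closing_mixed B Q hi 1 i hm2
    · exact isFace₂_closing_mixed B Q hi 2 i hm1
    · exact isFace₂_closing_mixed B Q hi 2 i hm2
    · exact isFace₂_closing_column B Q i _
    · exact isFace₂_closing_square B Q hji _
  have hCmem : ∀ f ∈ L, f ∈ C := fun f hf => List.mem_toFinset.mpr hf
  -- the family and the submodule
  set S' : Finset (Ty₂ B → ℤ) := S ∪ C with hS'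
  have hS'face : ∀ f ∈ S', IsFace₂ B f := by
    intro f hf
    rcases Finset.mem_union.mp hf with hf | hf
    · exact hSface f hf
    · exact hCface f hf
  set N : Submodule ℤ (Ty₂ B → ℤ) := pairs₂ B ⊔ spanMot B S' with hN
  have hNH : N ≤ hodge₂ B := sup_le (pairs₂_le_hodge₂ B) (spanMot_le_hodge₂ B fun f hf => mem_hodge₂_of_isFace₂ B (hS'face f hf))
  have hmot : ∀ x ∈ N, ∀ (e : Bool) (h : ZMod 4 × B), transl₂ B e h x ∈ N := fun x hx e h => transl₂_mem_sup B hx e h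
  have hP : pairs₂ B ≤ N := le_sup_left
  have hMS : spanMot B S ≤ N := (spanMot_mono B Finset.subset_union_left).trans le_sup_right
  have hCN : ∀ f ∈ L, f ∈ N := fun f hf =>
    le_sup_right (b := spanMot B S') (mem_spanMot_of_mem B (Finset.mem_union_right S (hCmem f hf)))
  have hcovN : ∀ y : Ty B, IsRes B y → (¬ ∃ (u : ZMod 4) (b : B), y = atom B u b 2) → UCovers B (N.comap (emb₀ B y)) :=
    fun y hy hy2 => ucovers_mono B (Submodule.comap_mono hMS) (hsl y hy hy2)
  have hsqN : ∀ (u : ZMod 4) (b : B) (k : ZMod 4) (u' : ZMod 4) (b' : B) (k' : ZMod 4), (k = 1 ∨ k = -1) → (k' = 1 ∨ k' = -1) →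
      tens B (Pi.single (atom B u b k) 1 - Pi.single (cst B u) 1) (Pi.single (atom B u' b' k') 1 - Pi.single (cst B u') 1) ∈ N :=
    fun u b k u' b' k' hk hk' => hMS (hsq u b k u' b' k' hk hk')
  have hShN : ∀ T : Ty₂ B, 2 ≤ pot B T → (¬ ∀ w, IsMin B w T.1) → (¬ ∀ w, IsMin B w T.2) → Shaped B N T :=
    fun T hT hb1 hb2 => shaped_mono B hMS (hShS T hT hb1 hb2)
  -- slices at the residual coordinates needed by the closing lemmas
  have pm1 : ∀ {k : ZMod 4}, (k = 1 ∨ k = -1) → k ≠ 0 := fun hk => by rcases hk with rfl | rfl <;> decide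
  have hcst : ∀ u : ZMod 4, UCovers B (N.comap (emb₀ B (cst B u))) := fun u =>
    hcovN _ ⟨u, i, 0, (atom_zero B u i).symm⟩ (fun ⟨u', b, h⟩ => atom_ne_cst B h3 (by decide) u h.symm)
  have hatm : ∀ (Δ : ZMod 4) (k : ZMod 4), (k = 1 ∨ k = -1) → UCovers B (N.comap (emb₀ B (atom B Δ i k))) := fun Δ k hk =>
    hcovN _ ⟨Δ, i, k, rfl⟩ (fun ⟨u', b, h⟩ => by
      have h2 := ((atom_eq_atom_iff B h3 (pm1 hk)).mp h).2.2
      rcases hk with rfl | rfl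
      · exact absurd h2 (by decide)
      · exact absurd h2 (by decide))
  -- the eight closing classes
  have hF1 : ∀ Δ k : ZMod 4, (Δ = 0 ∨ Δ = 1 ∨ Δ = 2) → (k = 1 ∨ k = -1) →
      tens B (Pi.single (cst B 0) 1 - Pi.single (cst B 1) 1) (Pi.single (cst B Δ) 1 - Pi.single (atom B Δ i k) 1) ∈ N := by
    intro Δ k hΔ hk
    refine closing_mixed_mem_upper B ha hn hQ hi hj hji hsqN Δ i hk (hatm Δ k hk) (hcst Δ) ?_
    rcases hΔ with rfl | rfl | rfl <;> rcases hk with rfl | rfl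
    · exact hCN (mixed 0 1) (by simp [L])
    · exact hCN (mixed 0 (-1)) (by simp [L])
    · exact hCN (mixed 1 1) (by simp [L])
    · exact hCN (mixed 1 (-1)) (by simp [L])
    · exact hCN (mixed 2 1) (by simp [L])
    · exact hCN (mixed 2 (-1)) (by simp [L])
  have hF2 : tens B (Xvec B 1 i + pairVec B (cst B 0) - pairVec B (atom B 0 i (-1))) (Pi.single (cst B 0) 1) ∈ N :=
    closing_column_mem_upper B ha hn hQ hi hj hji (hcst 0) (hCN col (by simp [L]))
  have hF3one : tens B ((∑ q ∈ Q, Xvec B 0 q) - Wvec B 1) (Pi.single (cst B 1) 1) ∈ N :=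
    closing_square_mem_upper B ha hn hQ hi hj hji (cst B 1) (hcst 1) (hCN eqf (by simp [L]))
  -- D-moves and X-lifts from the mixed and column classes
  have hD0 := D0_mem B hmot hF1
  have hD1 := D1_mem B hmot hF1
  have hX0 : ∀ (u : ZMod 4) (b : B) (u' : ZMod 4), tens B (Xvec B u b) (Pi.single (cst B u') 1) ∈ N :=
    X0_mem B hmot (X_col_mem B hD0 (X_base_mem B hP hD0 hF2))
  have hX1 := X1_mem B hmot hX0
  -- THE SCREW: the Weil lift `w_1 ⊗ e_0` without the equatorial face `⊗ e_0`
  have hW := cst_tens_Wvec_mem_of_screw B h3 hmot hP hsqN hD0 hD1 hX1 hShN hE1 hE2 hE3 hum hpq r1 r2 r12 (hMS hF₀S) (hMS hF₁S)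
  have hW10 := Wvec_one_tens_cst_zero_mem B hmot hW
  have hF3 : ∀ c : ZMod 4, (c = 0 ∨ c = 1) → tens B ((∑ q ∈ Q, Xvec B 0 q) - Wvec B 1) (Pi.single (cst B c) 1) ∈ N := by
    intro c hc
    rcases hc with rfl | rfl
    · rw [tens_sub_left, tens_sum_left]
      exact Submodule.sub_mem _ (Submodule.sum_mem _ fun q _ => hX0 0 q 0) hW10
    · exact hF3one
  obtain ⟨hX0', hX1', hW0, hW1, hD0', hD1'⟩ := closing_moves B hmot hP hF1 hF2 hF3
  -- generation
  have hgen : hodge₂ B ≤ N := by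
    intro x hx
    obtain ⟨r, hr, hsupp⟩ := exists_reduced₂ B (covers₂_mono B hMS hcov₂) x
    have hrH : r ∈ hodge₂ B := by
      have e : r = x - (x - r) := by abel
      rw [e]
      exact Submodule.sub_mem _ hx (hNH hr)
    have hrN : r ∈ N := residual₂_mem B h3 hNH hP hX0' hX1' hW0 hW1 hD0' hD1' hrH hsupp
    have e : x = (x - r) + r := by abel
    rw [e]
    exact Submodule.add_mem _ hr hrN
  -- count
  refine ⟨S', hS'face, hgen, ?_⟩
  have hsplit := card_blocks_split B
  have hten := ten_le_card_residual_blocks B h3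
  have hS'card : S'.card ≤ S.card + C.card := Finset.card_union_le S C
  omega

/-! ## §3 The law -/

/-- **THE OCTIC SCREW LAW: `μ_hodge(ℤ/8 × B, (4,0)) = β − 2` EXACTLY FOR EVERY FINITE GROUP `B` (`|B| ≥ 3`) WITH AN ELEMENT OF ORDER
DIVISIBLE BY `8`.**  (i) `β − 2` octic rank-four faces generate the octic Hodge lattice modulo the octic pairs, integrally; (ii) every
generating family of exponent vectors has at least `β − 2` members (the block-parity floor of part XXI). [folklore] -/
theorem octicTwist_law_screw (h3 : 3 ≤ Fintype.card B) (h8 : ∃ τ : B, 8 ∣ addOrderOf τ) :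
    (∃ S : Finset (Ty₂ B → ℤ), (∀ f ∈ S, IsFace₂ B f) ∧ hodge₂ B ≤ pairs₂ B ⊔ spanMot B S ∧
        S.card + 2 = Fintype.card (Orb₂ B)) ∧
      ∀ S : Finset (Ty₂ B → ℤ), hodge₂ B ≤ pairs₂ B ⊔ spanMot B S → Fintype.card (Orb₂ B) ≤ S.card + 2 := by
  obtain ⟨τ, hτ⟩ := h8
  refine ⟨?_, fun S hS => card_orb₂_le_card_add_two B h3 S hS⟩
  obtain ⟨S, hface, hgen, hcard⟩ := exists_faces_generate₂_screw B h3 hτ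
  exact ⟨S, hface, hgen, le_antisymm hcard (card_orb₂_le_card_add_two B h3 S hgen)⟩

end Summit.HodgeConjecture.CorCM.Census.OcticTwist
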